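import Summits.HodgeConjecture.HodgeConjecture.Theorems.VHCAbelianSchemesRoadDiagonalSingleCellCM
import Summits.HodgeConjecture.HodgeConjecture.Theorems.Ring2AbelianAllAndreGraded
import HarnessLib

/-!
# Road b02 (`VHCAbelianSchemesRoad`, D-0059) × the André axis — the JUNCTION, graded: ONE diagonal cell `(2M, M)` of the road's crux
# (with the door and the curve residual) gives the André-axis transport node at every relative dimension `d ≤ M + 2`; infinitely many
# cells give ring 2's compact-pencil node and the sub-cell's `B_min` of record `CMAnchoredTransport` (N104) outright

research route conditional on HC_CM; not a corollary; Q11.4-sentence-2 already refuted in dim ≥ 3.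
(cell line of seat ab-andre-2: research route, not a corollary; conditional on HC_CM plus one named minimal statement.)

THEOREMS ONLY (no definition, no named fact, no sorry; `HC_CM` occurs nowhere; no cell of the crux and no André-axis node is claimed).
Seat ab-andre-2 gen 56, PART Y-e (sequel of parts Y-a–Y-d). RING2-MAP §AbelianAll bookkeeping: the implication graph between the
road's graded carrier statement (regime K-SR♭∃ at the diagonal cells, `AdmissibleRepresentativesLefAtDeg 𝒪 (2M) M` /
`LefAtExceptionalRegimeAt (twisted door) (2M) M`) and the André axis's graded transport node
`Ring2.AbelianAll.CMAnchoredTransportAtRelDim d` (part V-graded, `Ring2AbelianAllAndreGraded.lean`) had only the UNGRADED edge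
«K-SR♭∃ ⟹ `AbelianSchemeVHC` ⟹ `CompactAbelianPencilVHC` ⟹ `CMAnchoredTransport`» (p408365 + `Ring2DeformCompactPencils`). Here, from
part Y-c's `invariantCyclesHoldFor_compactPencil_of_cellAbove`:
* §1 **`cmAnchoredTransportAtRelDim_of_lefAtDeg_cellAbove`** — door + curve residual + ONE cell `(2M, M)` ⟹ `CMAnchoredTransportAtRelDim d`
  for EVERY `d ≤ M + 2` (indeed VHC from ANY algebraic fibre, not only from CM fibres: `invariantCyclesHoldFor_compactPencil_of_cellAbove`);
  twisted-door form with K-C and Raynaud.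
* §2 **`compactAbelianPencilVHC_of_lefAtDeg_diagonal_frequently`**, **`cmAnchoredTransport_of_lefAtDeg_diagonal_frequently`** — door + curve
  residual + regime K-SR♭∃ at INFINITELY MANY diagonal cells ⟹ ring 2's node `Ring2.Deform.CompactAbelianPencilVHC` and the sub-cell's
  `B_min` of record `Ring2.AbelianAll.CMAnchoredTransport` (N104), fact-free; twisted-door forms.
READING (for the §AbelianAll implication graph): on both axes the graded statements are LINEARLY ORDERED AT THE NODE LEVEL — the André
axis by part XXXIII-f (`Ring2AbelianAllAndreLevelsMonotone.lean`: `LiftMidAt[k'] ⟹ LiftMidAt[k]`, `k ≤ k'`, pad + reflect + pad), the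
road by parts Y-a/Y-b (pure padding) — and ONE road cell `(2M, M)` sits ABOVE the whole André-axis transport column `d ≤ M + 2`. No converse
(transport ⟹ carriers) is claimed or expected.

References: [Andre1996Motifs] §6.3 Lemme 6.3.1, a) and Remarque 2 (pp. 31–33); [Abdulali1994FamiliesAV] (1.1), Lemma 6.2;
[BrosnanFangNiePearlstein2009] §6 Lemma 48; [Fulton1998] §10.1; [Lieberman1968]; [CharlesSchnell2014Notes] Prop. 11.3.11, Cor. 11.3.6;
[MumfordAV1970] §6; [GortzWedhorn2023] Thm. 27.291; [BuchweitzFlenner2003] §5 Thm. 5.1; [Pridham2024Semiregularity] Cor. 2.25, Rem. 2.27.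
-/

noncomputable section

open CategoryTheory CategoryTheory.Limits AlgebraicGeometry Topology

namespace Summit.HodgeConjecture.HodgeConjecture.Ring2.SemiregularRepresentatives

set_option linter.dupNamespace false -- the cell's namespace repeats the summit name, as in every `Ring2*` file

open Literature.AlgebraicGeometry Literature.AlgebraicGeometry.Motives Literature.AlgebraicGeometry.HodgeTheory
open Literature.AlgebraicTopology.SingularHomology
open Literature.AlgebraicGeometry.Andre1996 (andre1996_cmAnchoredPencil andre1996_cmHodgeClasses_algebraicallyAnchoredPencils)
open Summit.Ventures.HSemireg (ObjClass LocalVariationalHodgeFor)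
open Summit.HodgeConjecture.HodgeConjecture.Ring2.Hypotheses (AbelianSchemeVHC)
open Summit.HodgeConjecture.HodgeConjecture.Ring2.Binders
open Summit.HodgeConjecture.HodgeConjecture.Ring2.Deform (CompactAbelianPencilVHC compactAbelianPencilVHC_of_abelianSchemeVHC)
open Summit.HodgeConjecture.HodgeConjecture.Ring2.AbelianAll (CMAnchoredTransportAtRelDim CMAnchoredTransport
  cmAnchoredTransport_of_cmPointedPencilVHC cmPointedPencilVHC_of_compactAbelianPencilVHC)

/-! ## §1 One cell above the André-axis transport column -/

/-- **The André-axis graded transport node from ONE road cell**: the door `LocalVariationalHodgeFor 𝒪`, the curve residual and regime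
K-SR♭∃ at ONE diagonal cell `(2M, M)` give `CMAnchoredTransportAtRelDim d` — on every compact pencil of abelian `d`-folds algebraicity
spreads out of every CM fibre — for EVERY `d ≤ M + 2` (part Y-c gives VHC from ANY algebraic fibre, `InvariantCyclesHoldFor f d`).
[cite: Andre1996Motifs, §6.3 a) (p. 33)] [cite: Abdulali1994FamiliesAV, (1.1) and Lemma 6.2] [cite: BrosnanFangNiePearlstein2009, §6 Lemma 48]
[cite: Fulton1998, §10.1 Cor. 10.1] -/
theorem cmAnchoredTransportAtRelDim_of_lefAtDeg_cellAbove {𝒪 : ObjClass} (hT : LocalVariationalHodgeFor 𝒪)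
    (hqp : OneParameterAbelianSchemeQuasiProjective) {d M : ℕ} (hM : d ≤ M + 2)
    (hSR : AdmissibleRepresentativesLefAtDeg 𝒪 (2 * M) M) : CMAnchoredTransportAtRelDim d :=
  fun _ _ _ hf p W hW t _ ht s => invariantCyclesHoldFor_compactPencil_of_cellAbove hT hM hSR hqp hf p W hW ⟨t, ht⟩ s

/-- **The same over the road's TWISTED door**: K-C, the twisted door, Raynaud and regime 2 at ONE diagonal cell `(2M, M)` give
`CMAnchoredTransportAtRelDim d` for every `d ≤ M + 2`. [cite: Andre1996Motifs, §6.3 a) (p. 33)] [cite: Pridham2024Semiregularity, Cor. 2.25 and Rem. 2.27]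
[cite: GortzWedhorn2023, Thm. 27.291] [cite: vanGeemen1994HodgeAV, §2.4] -/
theorem cmAnchoredTransportAtRelDim_of_exceptionalRegimeAt_twisted_cellAbove (hC : ChernCharacterOnBetti)
    {Adm : PerfectAdmissibility} (hAdm : ∀ n X₀ I E, bfSingleAdmissible n X₀ I E → Adm n X₀ I E) {d M : ℕ} (hM : d ≤ M + 2)
    (hcell : ∀ C : ChernCharacterBetti, LefAtExceptionalRegimeAt (twistedReflexiveClass C Adm) (2 * M) M)
    (hDoor : ∀ C : ChernCharacterBetti, TwistedPerfectDoorVHC C Adm)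
    (hR : raynaud1970_abelianScheme_section_projective) : CMAnchoredTransportAtRelDim d := by
  obtain ⟨C⟩ := hC
  exact cmAnchoredTransportAtRelDim_of_lefAtDeg_cellAbove (𝒪 := twistedReflexiveClass C Adm) (hDoor C)
    (oneParameterAbelianSchemeQuasiProjective_of_raynaud1970 hR) hM
    (admissibleRepresentativesLefAtDeg_twisted_of_exceptionalRegimeAt C hAdm (hcell C))

/-! ## §2 Infinitely many cells above the ungraded nodes -/

/-- **Ring 2's compact-pencil node from infinitely many road cells**: the door, the curve residual and regime K-SR♭∃ at INFINITELY MANY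
diagonal cells give `Ring2.Deform.CompactAbelianPencilVHC` (VHC on every compact pencil of abelian varieties) — through row b02
(`abelianSchemeVHC_of_lefAtDeg_diagonal_frequently`, part Y-b) and `compactAbelianPencilVHC_of_abelianSchemeVHC`. Fact-free.
[cite: Andre1996Motifs, §6.3 Remarque 2 (p. 33)] [cite: Milne2020HodgeClassesAV, Rem. 3] [cite: BrosnanFangNiePearlstein2009, §6 Lemma 48] -/
theorem compactAbelianPencilVHC_of_lefAtDeg_diagonal_frequently {𝒪 : ObjClass} (hT : LocalVariationalHodgeFor 𝒪)
    (hSR : ∀ M : ℕ, ∃ m : ℕ, M ≤ m ∧ AdmissibleRepresentativesLefAtDeg 𝒪 (2 * m) m)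
    (hqp : OneParameterAbelianSchemeQuasiProjective) : CompactAbelianPencilVHC :=
  compactAbelianPencilVHC_of_abelianSchemeVHC (abelianSchemeVHC_of_lefAtDeg_diagonal_frequently hT hSR hqp)

/-- **The sub-cell's `B_min` of record (N104) from infinitely many road cells**: the door, the curve residual and regime K-SR♭∃ at
INFINITELY MANY diagonal cells give `Ring2.AbelianAll.CMAnchoredTransport` (algebraicity spreads out of every CM fibre of every compact
pencil of abelian varieties) — the statement which, with `HC_CM` and Lemme 6.3.1, gives `HC_AV` (`HC_AV_of_HC_CM_and_Bmin`). Fact-free;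
no converse claimed. [cite: Andre1996Motifs, §6.3 a) (p. 33)] [cite: Abdulali1994FamiliesAV, Lemma 6.2 (p. 1131)] [cite: BrosnanFangNiePearlstein2009, §6 Lemma 48] -/
theorem cmAnchoredTransport_of_lefAtDeg_diagonal_frequently {𝒪 : ObjClass} (hT : LocalVariationalHodgeFor 𝒪)
    (hSR : ∀ M : ℕ, ∃ m : ℕ, M ≤ m ∧ AdmissibleRepresentativesLefAtDeg 𝒪 (2 * m) m)
    (hqp : OneParameterAbelianSchemeQuasiProjective) : CMAnchoredTransport :=
  cmAnchoredTransport_of_cmPointedPencilVHC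
    (cmPointedPencilVHC_of_compactAbelianPencilVHC (compactAbelianPencilVHC_of_lefAtDeg_diagonal_frequently hT hSR hqp))

/-- **The same over the road's TWISTED door**: K-C, the twisted door, Raynaud and regime 2 at infinitely many diagonal cells (per Chern
character theory) give `CompactAbelianPencilVHC` and `CMAnchoredTransport`. [cite: Andre1996Motifs, §6.3 a) and Remarque 2 (p. 33)]
[cite: Pridham2024Semiregularity, Cor. 2.25 and Rem. 2.27] [cite: GortzWedhorn2023, Thm. 27.291] -/
theorem compactAbelianPencilVHC_and_cmAnchoredTransport_of_exceptionalRegimeAt_twisted_frequently (hC : ChernCharacterOnBetti)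
    {Adm : PerfectAdmissibility} (hAdm : ∀ n X₀ I E, bfSingleAdmissible n X₀ I E → Adm n X₀ I E)
    (hDiag : ∀ (C : ChernCharacterBetti) (M : ℕ), ∃ m : ℕ, M ≤ m ∧
      LefAtExceptionalRegimeAt (twistedReflexiveClass C Adm) (2 * m) m)
    (hDoor : ∀ C : ChernCharacterBetti, TwistedPerfectDoorVHC C Adm)
    (hR : raynaud1970_abelianScheme_section_projective) : CompactAbelianPencilVHC ∧ CMAnchoredTransport := by
  obtain ⟨C⟩ := hC
  have hSR : ∀ M : ℕ, ∃ m : ℕ, M ≤ m ∧ AdmissibleRepresentativesLefAtDeg (twistedReflexiveClass C Adm) (2 * m) m := fun M => by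
    obtain ⟨m, hm, h⟩ := hDiag C M
    exact ⟨m, hm, admissibleRepresentativesLefAtDeg_twisted_of_exceptionalRegimeAt C hAdm h⟩
  have h := compactAbelianPencilVHC_of_lefAtDeg_diagonal_frequently (hDoor C) hSR
    (oneParameterAbelianSchemeQuasiProjective_of_raynaud1970 hR)
  exact ⟨h, cmAnchoredTransport_of_cmPointedPencilVHC (cmPointedPencilVHC_of_compactAbelianPencilVHC h)⟩

/-! ## Audit: fact-free (closures are the three standard axioms; no named fact, no `HC_CM`) -/

#print axioms Summit.HodgeConjecture.HodgeConjecture.Ring2.SemiregularRepresentatives.cmAnchoredTransportAtRelDim_of_lefAtDeg_cellAbove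
#print axioms Summit.HodgeConjecture.HodgeConjecture.Ring2.SemiregularRepresentatives.compactAbelianPencilVHC_and_cmAnchoredTransport_of_exceptionalRegimeAt_twisted_frequently

end Summit.HodgeConjecture.HodgeConjecture.Ring2.SemiregularRepresentatives

end
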